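import Mathlib.MeasureTheory.Integral.DominatedConvergence
import Mathlib.MeasureTheory.Group.Integral
import Mathlib.Analysis.SpecialFunctions.Trigonometric.Basic
import Mathlib.Analysis.Complex.Exponential
import Literature.Analysis.Complex.LaplaceHalfLine
import HarnessLib

/-!
# Riemann–Lebesgue for the half-line Laplace transform, UNIFORMLY on vertical strips

Topic `Literature/Analysis/Complex`, continuation of `LaplaceHalfLine.lean`. Everything PROVED. For `g` continuous of exponential order `γ`
(`HalfLineExpBound g G γ`) and `γ < u₁ ≤ u₂`:

* `HalfLineExpBound.norm_laplaceC_le_half_integral_shiftGap` — the HALF-PERIOD TRANSLATION TRICK (the textbook proof of the Riemann–Lebesgue lemma,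
  e.g. Stein–Shakarchi, *Fourier Analysis*, or Schiff 1999 §4.2): with `a = π/|T|`, `e^{−iT(t+a)} = −e^{−iTt}`, so
  `2·𝓛g(u+iT) = ∫ [𝟙_{t>0}e^{−st}g(t) − e^{−ua}𝟙_{t>−a}e^{−st}g(t+a)] dt` and `‖𝓛g(u+iT)‖ ≤ ½∫ Φ_a`, where the majorant
  `Φ_a(t) = 𝟙_{t>0}e^{−u₁t}(‖g(t) − g(t+a)‖ + 2Ua‖g(t+a)‖) + 𝟙_{(−a,0]}(t)e^{2Ua}‖g(t+a)‖` (`shiftGap`) does NOT depend on `u ∈ [u₁, u₂]`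
  (`U = max(|u₁|, |u₂|)`, `0 < a ≤ 1/U ⊓ 1`);
* `HalfLineExpBound.tendsto_integral_shiftGap` — `∫ Φ_a → 0` as `a → 0⁺` (dominated convergence: continuity of `g` and the exponential bound);
* `HalfLineExpBound.exists_norm_laplaceC_le_uniform` — **uniform Riemann–Lebesgue on the strip**: for every `ε > 0` there is `T₀` with
  `‖𝓛g(u + iT)‖ ≤ ε` for all `|T| ≥ T₀` and ALL `u ∈ [u₁, u₂]`.

USE: the horizontal sides of a Bromwich rectangle `[u₁, u₂] × {±T}` for a renewal kernel that is merely continuous (cell ns-blowup, renewal route (R-c′)).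
NOT here: anything about a specific kernel.
-/

noncomputable section

open _root_.Complex _root_.MeasureTheory _root_.Set _root_.Filter _root_.Real
open scoped _root_.Topology

namespace Literature.Analysis.Complex

namespace HalfLineExpBound

variable {g : ℝ → ℂ} {G γ : ℝ}

/-! ### The shifted representation -/

/-- `‖e^{−st}‖ = e^{−(Re s)t}` (local copy of the kernel norm). [folklore] -/
private theorem norm_cexp_neg_mul (s : ℂ) (t : ℝ) : ‖cexp (-(s * t))‖ = Real.exp (-(s.re * t)) := by
  rw [Complex.norm_exp]; congr 1; simp [Complex.mul_re]

/-- The half-period phase: for `T ≠ 0` and `a = π/|T|`, `e^{−(u+iT)a} = −e^{−ua}`. [cite: Schiff1999, §4.2 (Riemann–Lebesgue lemma, proof)] -/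
theorem cexp_neg_mul_halfPeriod (u : ℝ) {T : ℝ} (hT : T ≠ 0) :
    cexp (-(((u : ℂ) + (T : ℂ) * I) * (((π / |T| : ℝ)) : ℂ))) = -((Real.exp (-(u * (π / |T|))) : ℝ) : ℂ) := by
  have hTa : (T : ℂ) * (((π / |T| : ℝ)) : ℂ) * I = ((T * (π / |T|) : ℝ) : ℂ) * I := by push_cast; ring
  rcases lt_or_gt_of_ne hT with hneg | hpos
  · have h1 : T * (π / |T|) = -π := by rw [abs_of_neg hneg]; field_simp
    rw [show -(((u : ℂ) + (T : ℂ) * I) * (((π / |T| : ℝ)) : ℂ)) = -((u : ℂ) * (((π / |T| : ℝ)) : ℂ)) + -((T : ℂ) * (((π / |T| : ℝ)) : ℂ) * I) by ring,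
      Complex.exp_add, hTa, h1]
    push_cast
    rw [neg_mul, neg_neg, Complex.exp_pi_mul_I]
    ring
  · have h1 : T * (π / |T|) = π := by rw [abs_of_pos hpos]; field_simp
    rw [show -(((u : ℂ) + (T : ℂ) * I) * (((π / |T| : ℝ)) : ℂ)) = -((u : ℂ) * (((π / |T| : ℝ)) : ℂ)) + -((T : ℂ) * (((π / |T| : ℝ)) : ℂ) * I) by ring,
      Complex.exp_add, hTa, h1]
    push_cast
    rw [Complex.exp_neg (↑π * I), Complex.exp_pi_mul_I, inv_neg, inv_one]
    ring

/-- The `u`-uniform majorant of the shifted difference (see the module docstring). [cite: Schiff1999, §4.2 (Riemann–Lebesgue lemma, proof)] -/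
def shiftGap (g : ℝ → ℂ) (u₁ U a t : ℝ) : ℝ :=
  Set.indicator (Ioi 0) (fun t => Real.exp (-(u₁ * t)) * (‖g t - g (t + a)‖ + 2 * U * a * ‖g (t + a)‖)) t +
    Set.indicator (Ioc (-a) 0) (fun t => Real.exp (2 * U * a) * ‖g (t + a)‖) t

/-- `shiftGap` is non-negative. [cite: Schiff1999, §4.2] -/
theorem shiftGap_nonneg (g : ℝ → ℂ) (u₁ : ℝ) {U a : ℝ} (hU : 0 ≤ U) (ha : 0 ≤ a) (t : ℝ) : 0 ≤ shiftGap g u₁ U a t := by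
  unfold shiftGap
  refine add_nonneg (Set.indicator_nonneg (fun t _ => ?_) t) (Set.indicator_nonneg (fun t _ => ?_) t)
  · positivity
  · positivity

/-- **The half-period translation bound**: for `T ≠ 0`, `a = π/|T|` with `a ≤ 1` and `U·a ≤ 1` (`U = max(|u₁|,|u₂|)`), and `u ∈ [u₁, u₂]` with `u₁ > γ`:
`‖𝓛g(u + iT)‖ ≤ ½ ∫ shiftGap g u₁ U a` (given integrability of the majorant, see `integrable_shiftGap`). [cite: Schiff1999, §4.2 (Riemann–Lebesgue lemma, proof)] -/
theorem norm_laplaceC_le_half_integral_shiftGap (h : HalfLineExpBound g G γ) {u₁ u₂ : ℝ} (hu₁ : γ < u₁) {u : ℝ} (hu : u ∈ Icc u₁ u₂)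
    {T : ℝ} (hT : T ≠ 0) (haU : max |u₁| |u₂| * (π / |T|) ≤ 1)
    (hint : Integrable (shiftGap g u₁ (max |u₁| |u₂|) (π / |T|))) :
    ‖laplaceC g (u + T * I)‖ ≤ 1 / 2 * ∫ t, shiftGap g u₁ (max |u₁| |u₂|) (π / |T|) t := by
  set a : ℝ := π / |T| with ha
  set U : ℝ := max |u₁| |u₂| with hU
  set s : ℂ := (u : ℂ) + (T : ℂ) * I with hs
  have ha0 : 0 < a := by rw [ha]; exact div_pos Real.pi_pos (abs_pos.2 hT)
  have hsre : s.re = u := by simp [hs]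
  have huγ : γ < u := lt_of_lt_of_le hu₁ hu.1
  have huU : |u| ≤ U := by
    rw [hU]; rcases le_or_gt 0 u with h0 | h0
    · rw [abs_of_nonneg h0]; exact le_trans (le_trans hu.2 (le_abs_self _)) (le_max_right _ _)
    · rw [abs_of_neg h0]; exact le_trans (by linarith [hu.1, neg_abs_le u₁, le_abs_self u₁, neg_le_abs u₁]) (le_max_left _ _)
  have hU0 : 0 ≤ U := le_trans (abs_nonneg _) (le_max_left _ _)
  -- the integrand on the line and its shift
  set H : ℝ → ℂ := Set.indicator (Ioi 0) (fun t : ℝ => cexp (-(s * t)) * g t) with hH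
  have hHint : Integrable H := (integrable_indicator_iff measurableSet_Ioi).2 (h.integrableOn (by rw [hsre]; exact huγ))
  have hL : laplaceC g s = ∫ t, H t := by rw [laplaceC, hH, integral_indicator measurableSet_Ioi]
  -- `∫ H = ∫ H(· + a)` and `H(t + a) = e^{−sa}·𝟙_{t > −a} e^{−st} g(t + a)`
  set H₁ : ℝ → ℂ := Set.indicator (Ioi (-a)) (fun t : ℝ => cexp (-(s * t)) * g (t + a)) with hH₁
  have hshift : ∀ t : ℝ, H (t + a) = cexp (-(s * a)) * H₁ t := by
    intro t
    rw [hH, hH₁]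
    by_cases ht : t ∈ Ioi (-a)
    · have ht' : t + a ∈ Ioi (0 : ℝ) := by simp only [mem_Ioi] at ht ⊢; linarith
      rw [Set.indicator_of_mem ht', Set.indicator_of_mem ht, ← mul_assoc, ← Complex.exp_add]
      congr 1; push_cast; ring_nf
    · have ht' : t + a ∉ Ioi (0 : ℝ) := by simp only [mem_Ioi, not_lt] at ht ⊢; linarith
      rw [Set.indicator_of_notMem ht', Set.indicator_of_notMem ht, mul_zero]
  have hphase : cexp (-(s * a)) = -((Real.exp (-(u * a)) : ℝ) : ℂ) := by
    rw [hs, ha]; exact cexp_neg_mul_halfPeriod u hT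
  have hH₁int : Integrable H₁ := by
    have h1 : Integrable (fun t => H (t + a)) := hHint.comp_add_right a
    have h2 : (fun t => H (t + a)) = fun t => cexp (-(s * a)) * H₁ t := funext hshift
    rw [h2] at h1
    have h3 := h1.const_mul (cexp (-(s * a)))⁻¹
    refine h3.congr (Eventually.of_forall fun t => ?_)
    simp only
    rw [← mul_assoc, inv_mul_cancel₀ (Complex.exp_ne_zero _), one_mul]
  have hL2 : laplaceC g s = -((Real.exp (-(u * a)) : ℝ) : ℂ) * ∫ t, H₁ t := by
    rw [hL, ← integral_add_right_eq_self H a]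
    simp_rw [hshift]
    rw [integral_const_mul, hphase]
  -- `2 𝓛 = ∫ (H − e^{−ua} H₁)`
  have htwo : (2 : ℂ) * laplaceC g s = ∫ t, (H t - ((Real.exp (-(u * a)) : ℝ) : ℂ) * H₁ t) := by
    rw [integral_sub hHint (hH₁int.const_mul _), integral_const_mul, two_mul]
    nth_rewrite 2 [hL2]
    rw [hL]; ring
  -- pointwise majorant
  have hpt : ∀ t : ℝ, ‖H t - ((Real.exp (-(u * a)) : ℝ) : ℂ) * H₁ t‖ ≤ shiftGap g u₁ U a t := by
    intro t
    rw [hH, hH₁, shiftGap]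
    have hua : |-(u * a)| ≤ 1 := by
      rw [abs_neg, abs_mul, abs_of_pos ha0]
      exact le_trans (mul_le_mul_of_nonneg_right huU ha0.le) haU
    by_cases ht0 : t ∈ Ioi (0 : ℝ)
    · have hta : t ∈ Ioi (-a) := by simp only [mem_Ioi] at ht0 ⊢; linarith
      have htn : t ∉ Ioc (-a) 0 := fun hh => not_le.2 (mem_Ioi.1 ht0) hh.2
      rw [Set.indicator_of_mem ht0, Set.indicator_of_mem hta, Set.indicator_of_mem ht0, Set.indicator_of_notMem htn, add_zero,
        ← mul_assoc, mul_comm (((Real.exp (-(u * a)) : ℝ) : ℂ)), mul_assoc, ← mul_sub, norm_mul, norm_cexp_neg_mul, hsre]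
      have he : Real.exp (-(u * t)) ≤ Real.exp (-(u₁ * t)) :=
        Real.exp_le_exp.2 (by nlinarith [hu.1, le_of_lt (mem_Ioi.1 ht0)])
      have hgap : ‖g t - ((Real.exp (-(u * a)) : ℝ) : ℂ) * g (t + a)‖ ≤ ‖g t - g (t + a)‖ + 2 * U * a * ‖g (t + a)‖ := by
        have e1 : g t - ((Real.exp (-(u * a)) : ℝ) : ℂ) * g (t + a) =
            (g t - g (t + a)) + ((1 - Real.exp (-(u * a)) : ℝ) : ℂ) * g (t + a) := by push_cast; ring
        rw [e1]
        refine (norm_add_le _ _).trans (add_le_add le_rfl ?_)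
        rw [norm_mul, Complex.norm_real, Real.norm_eq_abs]
        refine mul_le_mul_of_nonneg_right ?_ (norm_nonneg _)
        have h1 := Real.abs_exp_sub_one_le hua
        rw [abs_sub_comm] at h1
        calc |1 - Real.exp (-(u * a))| ≤ 2 * |-(u * a)| := h1
          _ = 2 * (|u| * a) := by rw [abs_neg, abs_mul, abs_of_pos ha0]
          _ ≤ 2 * U * a := by nlinarith [huU, ha0.le]
      exact mul_le_mul he hgap (norm_nonneg _) (Real.exp_pos _).le
    · rw [Set.indicator_of_notMem ht0, Set.indicator_of_notMem ht0, zero_sub, norm_neg, zero_add]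
      by_cases hta : t ∈ Ioi (-a)
      · have htc : t ∈ Ioc (-a) 0 := ⟨mem_Ioi.1 hta, not_lt.1 (fun hh => ht0 (mem_Ioi.2 hh))⟩
        rw [Set.indicator_of_mem hta, Set.indicator_of_mem htc, norm_mul, norm_mul, Complex.norm_real, Real.norm_eq_abs,
          abs_of_pos (Real.exp_pos _), norm_cexp_neg_mul, hsre, ← mul_assoc, ← Real.exp_add]
        refine mul_le_mul_of_nonneg_right (Real.exp_le_exp.2 ?_) (norm_nonneg _)
        have h1 : -(u * a) ≤ U * a := by nlinarith [neg_abs_le u, huU, ha0.le]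
        have h2 : -(u * t) ≤ U * a := by
          have : |u * t| ≤ U * a := by
            rw [abs_mul]
            exact mul_le_mul huU (by rw [abs_le]; constructor <;> linarith [htc.1, htc.2]) (abs_nonneg _) hU0
          linarith [neg_abs_le (u * t), le_abs_self (u * t), neg_le_abs (u*t)]
        linarith
      · have htc : t ∉ Ioc (-a) 0 := fun hh => hta (mem_Ioi.2 hh.1)
        rw [Set.indicator_of_notMem hta, Set.indicator_of_notMem htc, mul_zero, norm_zero]
  -- conclude
  have hnorm : ‖(2 : ℂ) * laplaceC g s‖ ≤ ∫ t, shiftGap g u₁ U a t := by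
    rw [htwo]
    refine (norm_integral_le_integral_norm _).trans (integral_mono_of_nonneg (Eventually.of_forall fun t => norm_nonneg _) hint
      (Eventually.of_forall hpt))
  rw [norm_mul, Complex.norm_two] at hnorm
  linarith

/-! ### The majorant: measurability, domination, limit -/

/-- The `a`-independent dominator of `shiftGap` for `0 < a ≤ 1`. [cite: Schiff1999, §4.2] -/
def shiftGapBound (G γ u₁ U t : ℝ) : ℝ :=
  Set.indicator (Ioi 0) (fun t => Real.exp (-(u₁ * t)) * ((G + (1 + 2 * U) * (G * Real.exp |γ|)) * Real.exp (γ * t))) t +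
    Set.indicator (Ioc (-1) 0) (fun _ => Real.exp (2 * U) * (G * Real.exp |γ|)) t

/-- `shiftGap` is a.e.-strongly measurable. [cite: Schiff1999, §4.2] -/
theorem aestronglyMeasurable_shiftGap (h : HalfLineExpBound g G γ) (u₁ U a : ℝ) :
    AEStronglyMeasurable (shiftGap g u₁ U a) volume := by
  have hc1 : Continuous fun t : ℝ => Real.exp (-(u₁ * t)) * (‖g t - g (t + a)‖ + 2 * U * a * ‖g (t + a)‖) := by
    have := h.continuous; fun_prop
  have hc2 : Continuous fun t : ℝ => Real.exp (2 * U * a) * ‖g (t + a)‖ := by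
    have := h.continuous; fun_prop
  exact (hc1.aestronglyMeasurable.indicator measurableSet_Ioi).add (hc2.aestronglyMeasurable.indicator measurableSet_Ioc)

/-- Shifted exponential bound: `‖g(t + a)‖ ≤ G e^{|γ|} e^{γt}` for `t + a ≥ 0`, `0 ≤ a ≤ 1`. [cite: Schiff1999, Definition 1.10] -/
theorem norm_shift_le (h : HalfLineExpBound g G γ) {a t : ℝ} (ha : 0 ≤ a) (ha1 : a ≤ 1) (hta : 0 ≤ t + a) :
    ‖g (t + a)‖ ≤ G * Real.exp |γ| * Real.exp (γ * t) := by
  refine (h.bound (t + a) hta).trans ?_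
  rw [mul_assoc, ← Real.exp_add]
  refine mul_le_mul_of_nonneg_left (Real.exp_le_exp.2 ?_) h.nonneg
  have : γ * a ≤ |γ| := by
    rcases le_or_gt 0 γ with h0 | h0
    · rw [abs_of_nonneg h0]; nlinarith
    · rw [abs_of_neg h0]; nlinarith
  linarith

/-- **Domination**: `shiftGap g u₁ U a ≤ shiftGapBound G γ u₁ U` pointwise for `0 < a ≤ 1`, `U ≥ 0`. [cite: Schiff1999, §4.2] -/
theorem shiftGap_le_bound (h : HalfLineExpBound g G γ) (u₁ : ℝ) {U a : ℝ} (hU : 0 ≤ U) (ha : 0 < a) (ha1 : a ≤ 1) (t : ℝ) :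
    shiftGap g u₁ U a t ≤ shiftGapBound G γ u₁ U t := by
  have hG := h.nonneg
  unfold shiftGap shiftGapBound
  refine add_le_add ?_ ?_
  · by_cases ht : t ∈ Ioi (0 : ℝ)
    · rw [Set.indicator_of_mem ht, Set.indicator_of_mem ht]
      have ht0 : 0 ≤ t := le_of_lt ht
      refine mul_le_mul_of_nonneg_left ?_ (Real.exp_pos _).le
      have h1 : ‖g t‖ ≤ G * Real.exp (γ * t) := h.bound t ht0
      have h2 : ‖g (t + a)‖ ≤ G * Real.exp |γ| * Real.exp (γ * t) := h.norm_shift_le ha.le ha1 (by linarith)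
      have h3 : ‖g t - g (t + a)‖ ≤ ‖g t‖ + ‖g (t + a)‖ := norm_sub_le _ _
      have h4 : 2 * U * a ≤ 2 * U := by nlinarith
      have h5 : 0 ≤ ‖g (t + a)‖ := norm_nonneg _
      nlinarith [mul_le_mul_of_nonneg_right h4 h5, Real.exp_pos (γ * t), Real.exp_pos |γ|]
    · rw [Set.indicator_of_notMem ht, Set.indicator_of_notMem ht]
  · by_cases ht : t ∈ Ioc (-a) 0
    · have ht1 : t ∈ Ioc (-1 : ℝ) 0 := ⟨by linarith [ht.1], ht.2⟩
      rw [Set.indicator_of_mem ht, Set.indicator_of_mem ht1]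
      have hta : 0 ≤ t + a := by linarith [ht.1]
      have h2 : ‖g (t + a)‖ ≤ G * Real.exp |γ| := by
        refine (h.bound (t + a) hta).trans (mul_le_mul_of_nonneg_left (Real.exp_le_exp.2 ?_) hG)
        have : |γ * (t + a)| ≤ |γ| := by
          rw [abs_mul]
          exact mul_le_of_le_one_right (abs_nonneg _) (by rw [abs_le]; constructor <;> linarith [ht.2])
        linarith [le_abs_self (γ * (t + a))]
      have h7 : Real.exp (2 * U * a) ≤ Real.exp (2 * U) := Real.exp_le_exp.2 (by nlinarith)
      exact mul_le_mul h7 h2 (norm_nonneg _) (Real.exp_pos _).le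
    · rw [Set.indicator_of_notMem ht]
      exact Set.indicator_nonneg (fun _ _ => by positivity) t

/-- The dominator is integrable for `u₁ > γ`. [cite: Schiff1999, §4.2] -/
theorem _root_.Literature.Analysis.Complex.integrable_shiftGapBound (G₀ : ℝ) {γ₀ u₁ : ℝ} (hu₁ : γ₀ < u₁) (U : ℝ) :
    Integrable (shiftGapBound G₀ γ₀ u₁ U) := by
  unfold shiftGapBound
  refine Integrable.add ?_ ?_
  · rw [integrable_indicator_iff measurableSet_Ioi]
    have h1 : IntegrableOn (fun t : ℝ => (G₀ + (1 + 2 * U) * (G₀ * Real.exp |γ₀|)) * Real.exp ((γ₀ - u₁) * t)) (Ioi 0) :=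
      (integrableOn_exp_mul_Ioi (by linarith) 0).const_mul _
    refine h1.congr_fun (fun t _ => ?_) measurableSet_Ioi
    simp only [show (γ₀ - u₁) * t = -(u₁ * t) + γ₀ * t by ring, Real.exp_add]; ring
  · rw [integrable_indicator_iff measurableSet_Ioc]
    exact integrableOn_const (by rw [Real.volume_Ioc]; exact ENNReal.ofReal_ne_top)

/-- **`shiftGap` is integrable** for `0 < a ≤ 1`, `U ≥ 0`, `u₁ > γ`. [cite: Schiff1999, §4.2] -/
theorem integrable_shiftGap (h : HalfLineExpBound g G γ) {u₁ : ℝ} (hu₁ : γ < u₁) {U a : ℝ} (hU : 0 ≤ U) (ha : 0 < a) (ha1 : a ≤ 1) :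
    Integrable (shiftGap g u₁ U a) :=
  Integrable.mono' (integrable_shiftGapBound G hu₁ U) (h.aestronglyMeasurable_shiftGap u₁ U a)
    (Eventually.of_forall fun t => by
      rw [Real.norm_eq_abs, abs_of_nonneg (shiftGap_nonneg g u₁ hU ha.le t)]
      exact h.shiftGap_le_bound u₁ hU ha ha1 t)

/-- **`∫ shiftGap → 0` as `a → 0⁺`** (dominated convergence; continuity of `g`). [cite: Schiff1999, §4.2 (Riemann–Lebesgue lemma, proof)] -/
theorem tendsto_integral_shiftGap (h : HalfLineExpBound g G γ) {u₁ : ℝ} (hu₁ : γ < u₁) {U : ℝ} (hU : 0 ≤ U) :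
    Tendsto (fun a : ℝ => ∫ t, shiftGap g u₁ U a t) (𝓝[>] 0) (𝓝 0) := by
  have hlim := tendsto_integral_filter_of_dominated_convergence (μ := volume) (l := 𝓝[>] (0 : ℝ))
    (F := fun a t => shiftGap g u₁ U a t) (f := fun _ => (0 : ℝ)) (shiftGapBound G γ u₁ U)
    (Eventually.of_forall fun a => h.aestronglyMeasurable_shiftGap u₁ U a) ?_ (integrable_shiftGapBound G hu₁ U) ?_
  · simpa using hlim
  · filter_upwards [Ioo_mem_nhdsGT (zero_lt_one' ℝ)] with a ha
    exact Eventually.of_forall fun t => by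
      rw [Real.norm_eq_abs, abs_of_nonneg (shiftGap_nonneg g u₁ hU ha.1.le t)]
      exact h.shiftGap_le_bound u₁ hU ha.1 ha.2.le t
  · have hae : ∀ᵐ t : ℝ ∂volume, t ≠ 0 := by
      simp only [ae_iff, not_not, Set.setOf_eq_eq_singleton, measure_singleton]
    filter_upwards [hae] with t ht
    rcases lt_or_gt_of_ne ht with hneg | hpos
    · -- `t < 0`: eventually (`a < −t`) the value is `0`
      refine tendsto_const_nhds.congr' ?_
      filter_upwards [Ioo_mem_nhdsGT (show (0 : ℝ) < -t by linarith)] with a ha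
      unfold shiftGap
      rw [Set.indicator_of_notMem (show t ∉ Ioi (0 : ℝ) from fun hh => by simp at hh; linarith),
        Set.indicator_of_notMem (show t ∉ Ioc (-a) 0 from fun hh => by linarith [hh.1, ha.2]), add_zero]
    · -- `t > 0`: a continuous function of `a` vanishing at `a = 0`
      have hcont : Continuous fun a : ℝ => Real.exp (-(u₁ * t)) * (‖g t - g (t + a)‖ + 2 * U * a * ‖g (t + a)‖) := by
        have := h.continuous; fun_prop
      have h0 : Real.exp (-(u₁ * t)) * (‖g t - g (t + 0)‖ + 2 * U * 0 * ‖g (t + 0)‖) = 0 := by simp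
      have hT := (hcont.tendsto 0).mono_left (nhdsWithin_le_nhds (s := Ioi (0 : ℝ)))
      rw [h0] at hT
      refine hT.congr' (Eventually.of_forall fun a => ?_)
      show _ = shiftGap g u₁ U a t
      unfold shiftGap
      rw [Set.indicator_of_mem (show t ∈ Ioi (0 : ℝ) from hpos),
        Set.indicator_of_notMem (show t ∉ Ioc (-a) 0 from fun hh => not_le.2 hpos hh.2), add_zero]

/-- **UNIFORM RIEMANN–LEBESGUE ON A STRIP.** For `g` continuous of exponential order `γ` and `γ < u₁ ≤ u₂`: for every `ε > 0` there is `T₀ > 0` such that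
`‖𝓛g(u + iT)‖ ≤ ε` for all `|T| ≥ T₀` and all `u ∈ [u₁, u₂]`. [cite: Schiff1999, §4.2 (Riemann–Lebesgue lemma)] -/
theorem exists_norm_laplaceC_le_uniform (h : HalfLineExpBound g G γ) {u₁ u₂ : ℝ} (hu₁ : γ < u₁) {ε : ℝ} (hε : 0 < ε) :
    ∃ T₀ : ℝ, 0 < T₀ ∧ ∀ T : ℝ, T₀ ≤ |T| → ∀ u ∈ Icc u₁ u₂, ‖laplaceC g (u + T * I)‖ ≤ ε := by
  set U : ℝ := max |u₁| |u₂| with hU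
  have hU0 : 0 ≤ U := le_trans (abs_nonneg _) (le_max_left _ _)
  have ht := h.tendsto_integral_shiftGap hu₁ hU0
  have hev : ∀ᶠ a in 𝓝[>] (0 : ℝ), ∫ t, shiftGap g u₁ U a t < 2 * ε := by
    have := (ht.eventually (gt_mem_nhds (show (0 : ℝ) < 2 * ε by linarith)))
    exact this
  obtain ⟨δ, hδ0, hδ⟩ := mem_nhdsGT_iff_exists_Ioo_subset.1 hev
  have hδ0' : 0 < δ := hδ0
  have hπ := Real.pi_pos
  have hπU : 0 ≤ π * U := mul_nonneg hπ.le hU0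
  have hπδ : 0 ≤ π / δ := div_nonneg hπ.le hδ0'.le
  have hT₀ : 0 < π / δ + π * U + π + 1 := by linarith
  refine ⟨π / δ + π * U + π + 1, hT₀, fun T hT u hu => ?_⟩
  have hTpos : 0 < |T| := lt_of_lt_of_le hT₀ hT
  have hT0 : T ≠ 0 := fun h0 => by rw [h0, abs_zero] at hTpos; exact lt_irrefl _ hTpos
  set a : ℝ := π / |T| with ha
  have ha0 : 0 < a := div_pos Real.pi_pos hTpos
  have haδ : a < δ := by
    rw [ha, div_lt_iff₀ hTpos]
    have : π / δ < |T| := by linarith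
    calc π = π / δ * δ := (div_mul_cancel₀ π (ne_of_gt hδ0')).symm
      _ < |T| * δ := mul_lt_mul_of_pos_right this hδ0'
      _ = δ * |T| := mul_comm _ _
  have ha1 : a ≤ 1 := by
    rw [ha, div_le_one hTpos]; linarith
  have haU : U * a ≤ 1 := by
    rw [ha, ← mul_div_assoc, div_le_one hTpos]
    nlinarith
  have hint := h.integrable_shiftGap hu₁ hU0 ha0 ha1
  have hmain := h.norm_laplaceC_le_half_integral_shiftGap hu₁ hu hT0 haU hint
  have hlt : ∫ t, shiftGap g u₁ U a t < 2 * ε := hδ ⟨ha0, haδ⟩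
  linarith

end HalfLineExpBound

end Literature.Analysis.Complex
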